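import Summits.BirchSwinnertonDyer.Rank1Residual.X11b.FrameIdealRigidity
import Summits.BirchSwinnertonDyer.BirchSwinnertonDyer.Theorems.CongruentShaFreeCutCharacterSupply
import HarnessLib

set_option linter.dupNamespace false -- `…BirchSwinnertonDyer.BirchSwinnertonDyer…` is the cell's namespace (D-0017)
set_option autoImplicit false

/-!
# Crux `PrintCf2.SplitBadTwoRankOneOfFacts` (item 20368), line `eisenstein_two_bdp_line` — LEMMA R at the prime `2`:
# the ♭-BDP frame's IDEAL `(Q) ⊆ 𝓞_{ℂ_p}⟦T⟧` does not depend on the periods, at EVERY prime `p` (so at `p = 2`),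
# hence the line's Eisenstein-inclusion / upgrade / IMC-equality sockets do not see the frame

Lead `bsd-line-cf2-p1` g5 (prover), cell `bsd-print-cf2`, 2026-08-28; `--supports stmt-BirchSwinnertonDyer-20368` (helper of the
registered line `eisenstein_two_bdp_line`, skeleton d31d09cefdf06587; closes nothing). THEOREMS ONLY (no definition, no named fact,
no `sorry`). HONEST FRAMING: elementary `p`-adic analysis on `𝓞_{ℂ_p}⟦T⟧` over two landed theorems; nothing here constructs a frame
(stub `stub_existsIntegralBDP_two` stays OPEN), proves an inclusion, or says anything about BSD.

WHY. The registered stubs `stub_flatEisensteinIncl_two` (`Ch·𝓞_{ℂ₂}⟦T⟧ ⊆ (Q)`), `stub_invariantUpgrade_two` (`(Q) ⊆ Ch·𝓞_{ℂ₂}⟦T⟧`)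
and the IMC socket of `stub_descent_two` (`Ch·𝓞_{ℂ₂}⟦T⟧ = (Q)`) quantify over EVERY ♭-frame `(Ω_K ≠ 0, Ω_p ≠ 0, Q)` with Castella's
interpolation property `R1.IsBDPLFunctionInt 2 ι′ 𝔭 κ γ f Ω_K Ω_p Q`. The X11b cell proved at every ODD `p` that two such frames differ
by a UNIT of `𝓞_{ℂ_p}⟦T⟧` (`X11b.R1.exists_unit_mul_eq_of_isBDPLFunctionInt`, `hp2 : p ≠ 2`, the parity entering only through the
interpolation-character supply `X11b.exists_interpolationCharacter`). Cell bsd-cn100 has since landed that supply at EVERY prime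
(`…Theorems.CongruentShaFreeCutCharacterSupply.exists_interpolationCharacter`, type-raised λ-supply, p442134). This file feeds the
any-prime supply into the X11b argument VERBATIM:

* `exists_unit_mul_eq_of_isBDPLFunctionInt_anyPrime` — `K` imaginary quadratic, `κ` anticyclotomic with topological generator `γ`,
  ANY prime `p`: two ♭-frames of the same `(ι, 𝔭, κ, γ, f)` with non-zero periods satisfy `Q′ = U·Q`, `U` a unit;
* `span_singleton_eq_of_isBDPLFunctionInt_anyPrime` — `(Q′) = (Q)`; `imcEqIntAt_iff_of_isBDPLFunctionInt_anyPrime` — the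
  main-conjecture conjunct `R1.IMCEqIntAt` does not see the frame (any `p`);
* at the literal prime `2`, for the line's sockets: `le_span_iff_of_isBDPLFunctionInt_two` (`I ≤ (Q) ↔ I ≤ (Q′)`),
  `span_le_iff_of_isBDPLFunctionInt_two` (`(Q) ≤ I ↔ (Q′) ≤ I`), `eq_span_iff_of_isBDPLFunctionInt_two` (`I = (Q) ↔ I = (Q′)`) — so each
  of stubs 2, 3 and the IMC socket of stub 4 holds for ONE frame iff for EVERY frame (the ∀-frame typing costs one frame, given
  `stub_existsIntegralBDP_two`).

References: Castella, Math. Ann. (2018) Thm. 3.1 (arXiv:1704.06608 p. 9) (interpolation shape); Castella–Hsieh 2018 §3.3; Washington,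
Introduction to Cyclotomic Fields §5.1 (the functions `(1+T)^x`); Weil 1956 §1–2 (the supply). BSD is not proved by any of this.
-/

noncomputable section

open scoped Classical Topology NumberField
open Filter Finset NumberField IsDedekindDomain Field PowerSeries
open Literature.NumberTheory.EllipticCurves Literature.NumberTheory.GaloisRepresentations
open Summit.BirchSwinnertonDyer.Rank1Residual.X11b.Three.LambdaSupply
open Summit.BirchSwinnertonDyer.Rank1Residual.X11b.LambdaSupply
open Summit.BirchSwinnertonDyer.Rank1Residual.X11b.Three.LambdaSupply.PadicUnits
open Summit.BirchSwinnertonDyer.Rank1Residual.X11b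

namespace Summit.BirchSwinnertonDyer.BirchSwinnertonDyer.Theorems.PrintCf2

variable {p : ℕ} [Fact p.Prime]

section Frames

variable {K : Type} [Field K] [NumberField K] {N : ℕ} {ι : PadicAlgCl p ≃+* ℂ}
  {𝔭 : HeightOneSpectrum (𝓞 K)} {κ : ZpExtension K p} {γ : Field.absoluteGaloisGroup K}
  {f : CuspForm (CongruenceSubgroup.Gamma0 N) 2} {ΩK ΩK' : ℂ} {Ωp Ωp' : ℂ_[p]}
  {Q Q' : PowerSeries 𝓞_ℂ_[p]}

/-- **IDEAL RIGIDITY ACROSS PERIODS AT EVERY PRIME — two ♭-frames differ by a unit.** Over an imaginary quadratic `K`, for an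
anticyclotomic `κ` with topological generator `γ` and ANY prime `p` (in particular `p = 2`): if
`R1.IsBDPLFunctionInt p ι 𝔭 κ γ f Ω_K Ω_p Q` and `R1.IsBDPLFunctionInt p ι 𝔭 κ γ f Ω_K' Ω_p' Q'` with all periods non-zero, then
`Q' = U·Q` for a unit `U` of `𝓞_{ℂ_p}⟦T⟧`. Proof = X11b's `R1.exists_unit_mul_eq_of_isBDPLFunctionInt` with the odd-prime supply
replaced by bsd-cn100's any-prime `CongruentShaFreeCutCharacterSupply.exists_interpolationCharacter`: test points = the values at `γ`
of the powers `φ₀^{p^a j}` of the interpolation character, `a` with `‖φ̂₀(γ)^{p^a} − 1‖ < p⁻¹`; the two frames' values there differ by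
`β^{m p^a j}` (`intSeries_hasValueAt_frame_rescale`); `R1.exists_unit_mul_eq_of_values` concludes.
[cite: Castella2018, Thm. 3.1 (arXiv:1704.06608 p. 9)] [cite: CastellaHsieh2018, §3.3, Def. 3.5 and Prop. 3.6] -/
theorem exists_unit_mul_eq_of_isBDPLFunctionInt_anyPrime (hK : IsImaginaryQuadratic K)
    (hκ : κ.IsAnticyclotomic) (hγ : κ.IsTopGenerator γ) (hΩK : ΩK ≠ 0) (hΩK' : ΩK' ≠ 0)
    (hΩp : Ωp ≠ 0) (hΩp' : Ωp' ≠ 0) (hQ : R1.IsBDPLFunctionInt p ι 𝔭 κ γ f ΩK Ωp Q)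
    (hQ' : R1.IsBDPLFunctionInt p ι 𝔭 κ γ f ΩK' Ωp' Q') :
    ∃ U : PowerSeries 𝓞_ℂ_[p], IsUnit U ∧ Q' = U * Q := by
  have hp : p.Prime := Fact.out
  -- the interpolation character and its value at `γ` (ANY prime: cell bsd-cn100's type-raised supply)
  obtain ⟨φ₀, m, ψ, hm, hunr, hinf, hav, hfac, hx1, hne⟩ :=
    Summit.BirchSwinnertonDyer.BirchSwinnertonDyer.Theorems.CongruentShaFreeCutCharacterSupply.exists_interpolationCharacter
      ι K κ hK hκ γ hγ
  set e := (FramedRep.unitsContinuousMulEquivOfUnique (Fin 1) (PadicAlgCl p) :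
    (PadicAlgCl p)ˣ →ₜ* GL (Fin 1) (PadicAlgCl p)) with he
  set x₀ : ℂ_[p] := avatarValueAt (e.comp ψ) γ with hx₀
  have hunr' : ∀ v : HeightOneSpectrum (𝓞 K), ((p : ℕ) : 𝓞 K) ∉ v.asIdeal → φ₀.IsUnramifiedAt v :=
    fun v _ => hunr v
  -- `a` with `‖x₀^{p^a} − 1‖ < p⁻¹`
  have hpinv : 0 < (p : ℝ)⁻¹ := inv_pos.mpr (by exact_mod_cast hp.pos)
  obtain ⟨a, ha⟩ : ∃ a : ℕ, ‖x₀ ^ p ^ a - 1‖ < (p : ℝ)⁻¹ := by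
    have h := tendsto_pow_prime_pow_padicComplex (p := p) hx1
    have hev := h.eventually (Metric.ball_mem_nhds (1 : ℂ_[p]) hpinv)
    obtain ⟨a, ha⟩ := hev.exists
    exact ⟨a, by rwa [dist_eq_norm] at ha⟩
  set x : ℂ_[p] := x₀ ^ p ^ a with hxdef
  have hxne : x ≠ 1 := hne a
  have hxlt : ‖x - 1‖ < 1 := ha.trans (inv_lt_one_of_one_lt₀ (by exact_mod_cast hp.one_lt))
  -- generic values of `Q`, `Q'` at the points `x^j − 1`
  have hpt : ∀ j : ℕ, ‖x ^ j - 1‖ < 1 := fun j => (R1.norm_pow_sub_one_le hxlt j).trans_lt hxlt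
  choose V hV using fun j : ℕ => intSeries_exists_hasValueAt Q (hpt j)
  choose V' hV' using fun j : ℕ => intSeries_exists_hasValueAt Q' (hpt j)
  -- the period ratio
  set β : ℂ_[p] := ((ι.symm ((ΩK / ΩK') ^ 4) : PadicAlgCl p) : ℂ_[p]) * (Ωp' / Ωp) ^ 4 with hβ
  have hβ0 : β ≠ 0 := by
    refine mul_ne_zero ?_ (pow_ne_zero _ (div_ne_zero hΩp' hΩp))
    rw [PadicComplex.coe_eq]
    exact (map_ne_zero_iff _ (algebraMap (PadicAlgCl p) ℂ_[p]).injective).mpr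
      ((map_ne_zero_iff _ ι.symm.injective).mpr (pow_ne_zero _ (div_ne_zero hΩK hΩK')))
  set b : ℂ_[p] := β ^ (m * p ^ a) with hbdef
  have hb : b ≠ 0 := pow_ne_zero _ hβ0
  -- the relation `V' j = b^j V j` for `j ≥ 1`, through the characters `φ₀^{p^a j}`
  have hrel : ∀ j, 0 < j → V' j = b ^ j * V j := by
    intro j hj
    set n : ℕ := p ^ a * j with hn
    have hn0 : 0 < m * n := Nat.mul_pos hm (Nat.mul_pos (pow_pos hp.pos a) hj)
    have hunrn : ∀ v : HeightOneSpectrum (𝓞 K), (φ₀ ^ n).IsUnramifiedAt v :=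
      fun v => isUnramifiedAt_pow' (hunr v) n
    have hinfn : (φ₀ ^ n).HasInfinityType (fun _ ↦ ((m * n : ℕ) : ℤ)) (fun _ ↦ -((m * n : ℕ) : ℤ)) := by
      have h := HasInfinityType.pow_nat hinf n
      convert h using 2 <;> push_cast <;> ring
    have havn : IsPAdicAvatarOf ι (φ₀ ^ n) (e.comp (ψ ^ n)) := isPAdicAvatarOf_pow ι hav hunr' n
    have hfacn : FactorsThroughZp κ (e.comp (ψ ^ n)) := factorsThroughZp_unitsChar_pow κ hfac n
    have hvaln : avatarValueAt (e.comp (ψ ^ n)) γ = x ^ j := by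
      rw [avatarValueAt_unitsChar_pow, ← hx₀, hxdef, ← pow_mul, hn]
    -- the values of the two frames at `x^j − 1`
    have h1 := hQ (φ₀ ^ n) (m * n) hn0 hunrn hinfn (e.comp (ψ ^ n)) havn hfacn
    have h2 := intSeries_hasValueAt_frame_rescale hΩK hΩK' hΩp hQ' hn0 hunrn hinfn havn hfacn
    rw [hvaln] at h1 h2
    have e1 : V j = _ := (hV j).unique h1
    have e2 : V' j = _ := (hV' j).unique h2
    rw [e2, e1, hbdef, ← hβ, ← pow_mul, show m * p ^ a * j = m * n by rw [hn]; ring]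
    ring
  exact R1.exists_unit_mul_eq_of_values ha hxne hb hV hV' hrel

/-- **Two ♭-frames generate the same ideal, at every prime**: `Ideal.span {Q'} = Ideal.span {Q}`.
[cite: Castella2018, Thm. 3.1 (arXiv:1704.06608 p. 9)] -/
theorem span_singleton_eq_of_isBDPLFunctionInt_anyPrime (hK : IsImaginaryQuadratic K)
    (hκ : κ.IsAnticyclotomic) (hγ : κ.IsTopGenerator γ) (hΩK : ΩK ≠ 0) (hΩK' : ΩK' ≠ 0)
    (hΩp : Ωp ≠ 0) (hΩp' : Ωp' ≠ 0) (hQ : R1.IsBDPLFunctionInt p ι 𝔭 κ γ f ΩK Ωp Q)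
    (hQ' : R1.IsBDPLFunctionInt p ι 𝔭 κ γ f ΩK' Ωp' Q') :
    Ideal.span ({Q'} : Set (PowerSeries 𝓞_ℂ_[p])) = Ideal.span {Q} := by
  obtain ⟨U, hU, hUQ⟩ := exists_unit_mul_eq_of_isBDPLFunctionInt_anyPrime hK hκ hγ hΩK hΩK' hΩp hΩp' hQ hQ'
  rw [hUQ]
  exact Ideal.span_singleton_mul_left_unit hU Q

/-- **The main-conjecture conjunct does not see the frame, at every prime**: for two ♭-frames of the same `(ι, 𝔭, κ, γ, f)` over an
imaginary quadratic `K` (`κ` anticyclotomic, non-zero periods), `R1.IMCEqIntAt W p κ 𝔭′ γ Q ↔ R1.IMCEqIntAt W p κ 𝔭′ γ Q'` for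
every prime `𝔭′` at which the Selmer condition is read. [cite: Castella2018, Thm. 3.1 (arXiv:1704.06608 p. 9)] -/
theorem imcEqIntAt_iff_of_isBDPLFunctionInt_anyPrime {W : WeierstrassCurve ℚ} (hK : IsImaginaryQuadratic K)
    (hκ : κ.IsAnticyclotomic) [hγ : Fact (κ.IsTopGenerator γ)] (hΩK : ΩK ≠ 0) (hΩK' : ΩK' ≠ 0)
    (hΩp : Ωp ≠ 0) (hΩp' : Ωp' ≠ 0) (hQ : R1.IsBDPLFunctionInt p ι 𝔭 κ γ f ΩK Ωp Q)
    (hQ' : R1.IsBDPLFunctionInt p ι 𝔭 κ γ f ΩK' Ωp' Q') (𝔭' : HeightOneSpectrum (𝓞 K)) :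
    R1.IMCEqIntAt W p κ 𝔭' γ Q ↔ R1.IMCEqIntAt W p κ 𝔭' γ Q' := by
  unfold R1.IMCEqIntAt
  rw [span_singleton_eq_of_isBDPLFunctionInt_anyPrime hK hκ hγ.out hΩK hΩK' hΩp hΩp' hQ hQ']

/-- **An inclusion INTO `(Q)` does not see the frame (any prime).** [cite: Castella2018, Thm. 3.1 (arXiv:1704.06608 p. 9)] -/
theorem le_span_iff_of_isBDPLFunctionInt_anyPrime (hK : IsImaginaryQuadratic K)
    (hκ : κ.IsAnticyclotomic) (hγ : κ.IsTopGenerator γ) (hΩK : ΩK ≠ 0) (hΩK' : ΩK' ≠ 0)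
    (hΩp : Ωp ≠ 0) (hΩp' : Ωp' ≠ 0) (hQ : R1.IsBDPLFunctionInt p ι 𝔭 κ γ f ΩK Ωp Q)
    (hQ' : R1.IsBDPLFunctionInt p ι 𝔭 κ γ f ΩK' Ωp' Q') (I : Ideal (PowerSeries 𝓞_ℂ_[p])) :
    I ≤ Ideal.span {Q} ↔ I ≤ Ideal.span {Q'} := by
  rw [span_singleton_eq_of_isBDPLFunctionInt_anyPrime hK hκ hγ hΩK hΩK' hΩp hΩp' hQ hQ']

/-- **An inclusion FROM `(Q)` does not see the frame (any prime).** [cite: Castella2018, Thm. 3.1 (arXiv:1704.06608 p. 9)] -/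
theorem span_le_iff_of_isBDPLFunctionInt_anyPrime (hK : IsImaginaryQuadratic K)
    (hκ : κ.IsAnticyclotomic) (hγ : κ.IsTopGenerator γ) (hΩK : ΩK ≠ 0) (hΩK' : ΩK' ≠ 0)
    (hΩp : Ωp ≠ 0) (hΩp' : Ωp' ≠ 0) (hQ : R1.IsBDPLFunctionInt p ι 𝔭 κ γ f ΩK Ωp Q)
    (hQ' : R1.IsBDPLFunctionInt p ι 𝔭 κ γ f ΩK' Ωp' Q') (I : Ideal (PowerSeries 𝓞_ℂ_[p])) :
    Ideal.span {Q} ≤ I ↔ Ideal.span {Q'} ≤ I := by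
  rw [span_singleton_eq_of_isBDPLFunctionInt_anyPrime hK hκ hγ hΩK hΩK' hΩp hΩp' hQ hQ']

/-- **An equality with `(Q)` does not see the frame (any prime).** [cite: Castella2018, Thm. 3.1 (arXiv:1704.06608 p. 9)] -/
theorem eq_span_iff_of_isBDPLFunctionInt_anyPrime (hK : IsImaginaryQuadratic K)
    (hκ : κ.IsAnticyclotomic) (hγ : κ.IsTopGenerator γ) (hΩK : ΩK ≠ 0) (hΩK' : ΩK' ≠ 0)
    (hΩp : Ωp ≠ 0) (hΩp' : Ωp' ≠ 0) (hQ : R1.IsBDPLFunctionInt p ι 𝔭 κ γ f ΩK Ωp Q)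
    (hQ' : R1.IsBDPLFunctionInt p ι 𝔭 κ γ f ΩK' Ωp' Q') (I : Ideal (PowerSeries 𝓞_ℂ_[p])) :
    I = Ideal.span {Q} ↔ I = Ideal.span {Q'} := by
  rw [span_singleton_eq_of_isBDPLFunctionInt_anyPrime hK hκ hγ hΩK hΩK' hΩp hΩp' hQ hQ']

end Frames

/-! ### The line's three sockets at the literal prime `2` do not see the frame -/

section Two

variable {K : Type} [Field K] [NumberField K] {N : ℕ} {ι : PadicAlgCl 2 ≃+* ℂ}
  {𝔭 𝔭' : HeightOneSpectrum (𝓞 K)} {κ : ZpExtension K 2} {γ : Field.absoluteGaloisGroup K}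
  {f : CuspForm (CongruenceSubgroup.Gamma0 N) 2} {ΩK ΩK' : ℂ} {Ωp Ωp' : ℂ_[2]}
  {Q Q' : PowerSeries 𝓞_ℂ_[2]}

/-- **Socket of `stub_flatEisensteinIncl_two` (`Ch·𝓞_{ℂ₂}⟦T⟧ ⊆ (Q)`), of `stub_invariantUpgrade_two` (`(Q) ⊆ Ch·𝓞_{ℂ₂}⟦T⟧`) and of
the IMC hypothesis of `stub_descent_two` (`Ch·𝓞_{ℂ₂}⟦T⟧ = (Q)`), for EVERY `2`-adic ♭-frame ⟺ for ONE frame**: over an imaginary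
quadratic `K` with `κ` anticyclotomic (topological generator `γ`), two frames `R1.IsBDPLFunctionInt 2 ι 𝔭 κ γ f Ω_K Ω_p Q`,
`… Ω_K' Ω_p' Q'` with non-zero periods give, for the characteristic ideal read in `𝓞_{ℂ₂}⟦T⟧` (indeed for ANY ideal `I`),
`(I ≤ (Q) ↔ I ≤ (Q')) ∧ ((Q) ≤ I ↔ (Q') ≤ I) ∧ (I = (Q) ↔ I = (Q'))`. [cite: Castella2018, Thm. 3.1 (arXiv:1704.06608 p. 9)] -/
theorem sockets_iff_of_isBDPLFunctionInt_two (W : WeierstrassCurve ℚ) (hK : IsImaginaryQuadratic K)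
    (hκ : κ.IsAnticyclotomic) [hγ : Fact (κ.IsTopGenerator γ)] (hΩK : ΩK ≠ 0) (hΩK' : ΩK' ≠ 0)
    (hΩp : Ωp ≠ 0) (hΩp' : Ωp' ≠ 0) (hQ : R1.IsBDPLFunctionInt 2 ι 𝔭 κ γ f ΩK Ωp Q)
    (hQ' : R1.IsBDPLFunctionInt 2 ι 𝔭 κ γ f ΩK' Ωp' Q') :
    let I := (AcSelmer.XAc.charIdeal (W.baseChange K) 2 κ 𝔭' ∅ γ).map (PowerSeries.map (R1.toCpInt 2))
    (I ≤ Ideal.span {Q} ↔ I ≤ Ideal.span {Q'}) ∧ (Ideal.span {Q} ≤ I ↔ Ideal.span {Q'} ≤ I) ∧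
      (I = Ideal.span {Q} ↔ I = Ideal.span {Q'}) := by
  intro I
  exact ⟨le_span_iff_of_isBDPLFunctionInt_anyPrime hK hκ hγ.out hΩK hΩK' hΩp hΩp' hQ hQ' I,
    span_le_iff_of_isBDPLFunctionInt_anyPrime hK hκ hγ.out hΩK hΩK' hΩp hΩp' hQ hQ' I,
    eq_span_iff_of_isBDPLFunctionInt_anyPrime hK hκ hγ.out hΩK hΩK' hΩp hΩp' hQ hQ' I⟩

end Two

end Summit.BirchSwinnertonDyer.BirchSwinnertonDyer.Theorems.PrintCf2
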